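import Literature.MathematicalPhysics.QuantumFieldTheory.BalabanImbrieJaffe1984to88.BIJ88DeltaLocClose235General
import Literature.MathematicalPhysics.QuantumFieldTheory.BalabanImbrieJaffe1984to88.BIJ88NeumannPropagatorSmallFieldSupDecay

/-!
# `BalabanImbrieJaffe1984to88.BIJ88Decay230SmallPlaquetteCubes` — T. Bałaban, J. Imbrie, A. Jaffe, *Effective action and cluster properties of
the abelian Higgs model*, Commun. Math. Phys. **114** (1988) 257–315 [BalabanImbrieJaffe1988], Sect. 2 p. 263 [PDF 7]: **(2.30) FOR `G_{k,loc}(u)`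
AND (2.36) FOR `Δ_{k,loc}(u)` OVER A FAMILY OF TORUS CUBES AT A SMALL-PLAQUETTE BACKGROUND — NO GAUGE CONDITION** — the plaquette twin of this
seat's gen 20 `BIJ88Decay230SmallFieldCubes` (which asks the BONDWISE smallness `(T, δ)` of `u` inside the cubes): p27 g34's
`BIJ88NeumannPropagatorSmallFieldSupDecay.decay110_smallPlaquette_cube_uniform` (v1.2, p349473; [6] (1.10), `k`-uniform `‖f‖_∞` form, cube
Neumann propagators, under the PRINTED plaquette smallness `‖u(∂p) − 1‖ ≤ θ` only, threshold depending on `(d, L^k)` — the gauge is fixed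
internally, block by block, by p30/p34's centred axial gauge) fed into this seat's `opDecay230_of_input` / `decay236_of_input`.

statement-level skeleton of published theorems with citation tags; proofs where landed; nothing here is a claim about the Yang–Mills mass gap

PDF held: `paper:balaban1988-cmp114-bij-abelian-higgs-effective-action` (journal page = PDF page + 256; p. 263 [PDF 7]); [I] =
`paper:balaban1985-cmp97-bij-higgs-minimizers` p. 326 [PDF 28] (7.3.1) *«|v(∂p) − 1| ≦ e_kμ(e_k)»* (re-read this session).

CITATION HEADER (lean-in-tree rule).  lit-balaban cell (HOME `run/shared/lean/pub/lit-balaban/`), Phase 2, proof seat **p31 gen 21** (unit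
`lit-balaban-p31`, literature-prover-lit-balaban-p31-g21-0), free-target protocol G.5-34(d) (p27 g34's hand-over 2026-08-23T02:20:45Z in
`HOME/lit-balaban-p31/INBOX.md`: *"your (H1.10) binder for the cube … under the PRINTED plaquette smallness … NO gauge condition"*).  Rows of
`HOME/lit-balaban-r18/ROWS-C2.md` served (LOCATED MEMBERS, cells only; heads unchanged; owner r18): **C2.Eq2.30**, **C2.Eq2.36** «at a
small-PLAQUETTE non-flat `u`, no gauge condition»; [6]-input row **B4.Thm@573** (1.10) (owner r01) enters BY NAME through p27's member.  Files USED
BY NAME: this seat's `BIJ88DeltaLocClose235General` (`opDecay230_of_input`, `decay236_of_input`; p346675), p27's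
`BIJ88NeumannPropagatorSmallFieldSupDecay` v1.2 (`decay110_smallPlaquette_cube_uniform`; p349473).

THE PRINTED TEXT (verbatim, p. 263 [PDF 7]).  *"|(G_{k,loc}(u)f)(x)| ≦ ce^{−c dist(suppt f,x)}‖f‖_∞, (2.30) … We assume that u is smooth in the
□_α's entering the sum in (2.27)"*; *"|Δ_{k,loc}(u;x₁,x₂)| ≦ ce^{−c|x₁−x₂|}, (2.36)"*.  Here *"u smooth in the □_α's"* is the plaquette condition
`‖u(∂p) − 1‖ ≤ θ` with `(d′−1)(L^k−1)θ ≤ T`, `2(L^k−1)L^k·d′·T² + 2(d′(L^k−1)T)² ≤ ½` (met when `8d′⁴L^{4k}θ² ≤ ½`), on tori with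
`2(L^k − 1) + 4 < |T^{(0)}|`.

WHAT IS PROVED (theorems only; 0 `sorry`; standard axioms).
* **`opDecay230_smallPlaquette`** — (2.30), OPERATOR FORM, for `G_{k,loc}(u) = gLocT (α_kL^{kd′}) ε⁻¹ u k cube λ ζ″` over ANY finite family of no-wrap
  torus cubes `□_α = c_α·L^k + Π_i[0, L^kM_{α,i})` (fitting, shorter than the torus), weights `Σ_α|λ_α| ≤ 1`, cut-off `|ζ″| ≤ 1`, at every `U(1)` field `u` with
  `‖u(∂p) − 1‖ ≤ θ` and the two numeric conditions above: `‖(G_{k,loc}(u)f)(x)‖ ≤ s_k²·#S·c₀e^{−δ₀D/L^k}·F` (constants `δ₀, c₀ > 0` from `(d, ℓ, a)`).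
* **`decay236_smallPlaquette`** — (2.36) for `Δ_{k,loc}(u)` at the same data: `‖Δ_{k,loc}(u; y₁,y₂)‖ ≤ A·([y₁ = y₂] + #S·a_k·c₀e^{δ₀}·e^{−δ₀|y₁−y₂|_{T^{(k)}}})`.
HONEST SCOPE.  As gen 20's file: (i) exactly the two members whose only [6]-input is (1.10) for the cubes; (ii) `d′ = d + 1 ≤ 3`, fine level `0`,
`1 ≤ k ≤ m + K`; constants of p27's member, uniform in the torus, `k`, `u`, the cube family; (iii) the data hypotheses as in gen 16/17; (iv) value
members only.  Imports: `BIJ88DeltaLocClose235General` (v1.1), `BIJ88NeumannPropagatorSmallFieldSupDecay` (v1.2, p349473).  Literature + Mathlib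
only.  Unit `lit-balaban-p31` (literature-prover-lit-balaban-p31-g21-0), 2026-08-23.  NOT summit progress.
-/

open scoped BigOperators Matrix ComplexConjugate
open Finset Matrix

namespace Literature.MathematicalPhysics.QuantumFieldTheory.BalabanImbrieJaffe1984to88.BIJ88Decay230SmallPlaquetteCubes

open Literature.MathematicalPhysics.QuantumFieldTheory.Balaban1983to89
open BIJ88Sect3Statements (U1 toC)
open GaugeField (plaqHol)
open BIJ85BlockAveragesTorus BIJ85BlockAveragesTorusK
open BIJ88NeumannPropagator227Torus (gBox)
open BIJ88DeltaLoc234Torus (gLocT deltaLocT)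
open BIJ88NeumannPropagatorFlatDecayCube (cubeT)
open BIJ88NeumannPropagatorSmallFieldSupDecay (decay110_smallPlaquette_cube_uniform)
open BIJ88DeltaLocClose235General (opDecay230_of_input decay236_of_input)

noncomputable section

/-- **(2.30), OPERATOR FORM, FOR `G_{k,loc}(u)` OVER A FAMILY OF TORUS CUBES AT A SMALL-PLAQUETTE `u`, no gauge condition** (p. 263 (2.30)):
p27's `decay110_smallPlaquette_cube_uniform` ([6] (1.10), `k`-uniform `‖f‖_∞` form, cubes, `‖u(∂p) − 1‖ ≤ θ`) in this seat's `opDecay230_of_input`.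
[cite: BalabanImbrieJaffe1988, (2.30) p.263] -/
theorem opDecay230_smallPlaquette (d ℓ : ℕ) (hd3 : d + 1 ≤ 3) (hℓ : 1 ≤ ℓ) {a : ℝ} (ha : 0 < a) :
    ∃ δ₀ c₀ : ℝ, 0 < δ₀ ∧ 0 < c₀ ∧ ∀ (P : Params) (hPd : P.d = d + 1), P.L = ℓ + 1 →
      ∀ k : ℕ, 1 ≤ k → k ≤ P.m + P.K → ∀ (ι : Type) [Fintype ι] (cube : ι → Finset (Balaban1983to89.Site P 0))
        (lam : ι → Balaban1983to89.Site P 0 → Balaban1983to89.Site P 0 → ℝ)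
        (ζ'' : Balaban1983to89.Site P 0 → Balaban1983to89.Site P 0 → ℝ), 2 * (P.L ^ k - 1) + 4 < P.sitesPerDir 0 →
        (∀ α, ∃ c M : Fin (d + 1) → ℕ, (∀ i, 1 ≤ M i) ∧ (∀ i, c i * P.L ^ k + P.L ^ k * M i ≤ P.sitesPerDir 0) ∧
            (∀ i, P.L ^ k * M i < P.sitesPerDir 0) ∧ cube α = cubeT hPd (P.L ^ k) c fun i => P.L ^ k * M i) →
        (∀ x y, ∑ α, |lam α x y| ≤ 1) → (∀ x y, |ζ'' x y| ≤ 1) →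
      ∀ (U : GaugeField P 0 U1) (θ : ℝ), 0 ≤ θ → (∀ p : Balaban1983to89.Plaq P 0, ‖toC (plaqHol U p) - 1‖ ≤ θ) →
      ∀ (T : ℝ), ((P.d - 1 : ℕ) : ℝ) * ((P.L : ℝ) ^ k - 1) * θ ≤ T →
        2 * (((P.L : ℝ) ^ k - 1) * (P.L : ℝ) ^ k) * P.d * T ^ 2 + 2 * (P.d * ((P.L : ℝ) ^ k - 1) * T) ^ 2 ≤ 1 / 2 →
      ∀ (x : Balaban1983to89.Site P 0) (f : Balaban1983to89.Site P 0 → ℂ) (F D : ℝ),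
        (∀ y, ‖f y‖ ≤ F) → (∀ y, f y ≠ 0 → D ≤ B5Ineq137Torus.T P 0 x y) →
      ∀ S : Finset ι, (∀ α y, ζ'' x y * lam α x y ≠ 0 → f y ≠ 0 → α ∈ S) →
        ‖(gLocT (B1RG242Torus.α P a k * (P.L : ℝ) ^ (k * P.d)) P.eps⁻¹ U k cube lam ζ'' *ᵥ f) x‖ ≤
          P.spacing k ^ 2 * (S.card * (c₀ * Real.exp (-(δ₀ * (((P.L : ℝ) ^ k)⁻¹ * D))) * F)) := by
  obtain ⟨δ₀, c₀, hδ₀, hc₀, H⟩ := decay110_smallPlaquette_cube_uniform d ℓ hd3 hℓ ha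
  refine ⟨δ₀, c₀, hδ₀, hc₀, ?_⟩
  intro P hPd hPL k hk1 hk ι _ cube lam ζ hR hcube hlam hζ U θ hθ0 hplaq T hT hsmall x f F D hF hsupp S hS
  refine opDecay230_of_input _ _ U cube hlam hζ (fun α x' g G E hG hsuppg => ?_) x f F D hF hsupp S hS
  obtain ⟨c, M, hM, hfit, hN, hc⟩ := hcube α
  rw [hc]
  exact H P hPd hPL k hk1 hk hR U θ hθ0 hplaq T hT hsmall c M hM hfit hN x' g G E hG hsuppg

/-- **(2.36) FOR `Δ_{k,loc}(u)` OVER A FAMILY OF TORUS CUBES AT A SMALL-PLAQUETTE `u`, no gauge condition** (p. 263 (2.36)): p27's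
`decay110_smallPlaquette_cube_uniform` in this seat's `decay236_of_input` (the `Q_k(u)G_{k,loc}(u)Q_k(u)ᴴ` sandwich at the block lower bound of the metric,
prefactor `A²s_k²L^{−kd′} = A·a_k`). [cite: BalabanImbrieJaffe1988, (2.36) p.263] -/
theorem decay236_smallPlaquette (d ℓ : ℕ) (hd3 : d + 1 ≤ 3) (hℓ : 1 ≤ ℓ) {a : ℝ} (ha : 0 < a) :
    ∃ δ₀ c₀ : ℝ, 0 < δ₀ ∧ 0 < c₀ ∧ ∀ (P : Params) (hPd : P.d = d + 1), P.L = ℓ + 1 →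
      ∀ k : ℕ, 1 ≤ k → k ≤ P.m + P.K → ∀ (ι : Type) [Fintype ι] (cube : ι → Finset (Balaban1983to89.Site P 0))
        (lam : ι → Balaban1983to89.Site P 0 → Balaban1983to89.Site P 0 → ℝ)
        (ζ'' : Balaban1983to89.Site P 0 → Balaban1983to89.Site P 0 → ℝ), 2 * (P.L ^ k - 1) + 4 < P.sitesPerDir 0 →
        (∀ α, ∃ c M : Fin (d + 1) → ℕ, (∀ i, 1 ≤ M i) ∧ (∀ i, c i * P.L ^ k + P.L ^ k * M i ≤ P.sitesPerDir 0) ∧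
            (∀ i, P.L ^ k * M i < P.sitesPerDir 0) ∧ cube α = cubeT hPd (P.L ^ k) c fun i => P.L ^ k * M i) →
        (∀ x y, ∑ α, |lam α x y| ≤ 1) → (∀ x y, |ζ'' x y| ≤ 1) →
      ∀ (U : GaugeField P 0 U1) (θ : ℝ), 0 ≤ θ → (∀ p : Balaban1983to89.Plaq P 0, ‖toC (plaqHol U p) - 1‖ ≤ θ) →
      ∀ (T : ℝ), ((P.d - 1 : ℕ) : ℝ) * ((P.L : ℝ) ^ k - 1) * θ ≤ T →
        2 * (((P.L : ℝ) ^ k - 1) * (P.L : ℝ) ^ k) * P.d * T ^ 2 + 2 * (P.d * ((P.L : ℝ) ^ k - 1) * T) ^ 2 ≤ 1 / 2 →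
      ∀ (y₁ y₂ : Balaban1983to89.Site P (0 + k)) (S : Finset ι),
        (∀ x ∈ blockK k y₁, ∀ α y, ζ'' x y * lam α x y ≠ 0 → α ∈ S) →
        ‖deltaLocT (B1RG242Torus.α P a k * (P.L : ℝ) ^ (k * P.d)) P.eps⁻¹ U k cube lam ζ'' y₁ y₂‖ ≤
          (B1RG242Torus.α P a k * (P.L : ℝ) ^ (k * P.d)) *
            ((if y₁ = y₂ then 1 else 0) +
              S.card * B1.aSeq a P.L k * (c₀ * Real.exp δ₀) * Real.exp (-(δ₀ * (B5Ineq137Torus.T P (0 + k) y₁ y₂)))) := by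
  obtain ⟨δ₀, c₀, hδ₀, hc₀, H⟩ := decay110_smallPlaquette_cube_uniform d ℓ hd3 hℓ ha
  refine ⟨δ₀, c₀, hδ₀, hc₀, ?_⟩
  intro P hPd hPL k hk1 hk ι _ cube lam ζ hR hcube hlam hζ U θ hθ0 hplaq T hT hsmall y₁ y₂ S hS
  have hk0 : 0 + k ≤ P.m + P.K := by omega
  refine decay236_of_input hk1 hk0 ha P.eps⁻¹ U cube hlam hζ hδ₀.le hc₀.le (fun α x' g G E hG hsuppg => ?_) y₁ y₂ S hS
  obtain ⟨c, M, hM, hfit, hN, hc⟩ := hcube α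
  rw [hc]
  exact H P hPd hPL k hk1 hk hR U θ hθ0 hplaq T hT hsmall c M hM hfit hN x' g G E hG hsuppg

end

end Literature.MathematicalPhysics.QuantumFieldTheory.BalabanImbrieJaffe1984to88.BIJ88Decay230SmallPlaquetteCubes
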